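import Mathlib.MeasureTheory.Integral.Bochner.Basic
import Mathlib.MeasureTheory.Integral.Bochner.Set
import Mathlib.MeasureTheory.Measure.Lebesgue.Basic
import HarnessLib

/-!
# The cut-cone representation of `ℓ₁^N`-distances as an integral over super-level cuts

Family `pnp`, layer `Literature/Geometry/MetricEmbeddings`; measure-theoretic sibling of
`CutCone.lean` (which treats finitely many cuts on a finite set). Source: J. Cheeger, B. Kleiner,
A. Naor, arXiv:0910.2026 = Acta Math. 207 (2011), §2 (arXiv p. 7): "The approach of [CK10]
starts out with the cut-cone representation of `L₁` metrics (see [DL97, CK10]), which asserts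
that for every `f : ℍ → L₁` we can write `‖f(x) − f(y)‖_{L₁} = ∫_{2^ℍ} |χ_E(x) − χ_E(y)| dΣ_f(E)`
for all `x, y`, where `Σ_f` is a canonically defined measure on `2^ℍ`". For an `ℓ₁^N`-valued map
`f = (f_k)` on ANY type this is the one-dimensional layer-cake formula applied coordinatewise, with
`Σ_f` the image of (counting measure on `Fin N`) ⊗ (Lebesgue measure) under
`(k, θ) ↦ E_{k,θ} = {p | θ < f_k(p)}`; this is the form in which the cut measure of the maps
quantified over in `CheegerKleinerNaor2011_wordBall_l1Distortion` (targets `ℓ₁^N`) arises.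

PROVED here (no named facts): `abs_indicator_Iio_sub` (pointwise
`|𝟙_{θ<a} − 𝟙_{θ<b}| = 𝟙_{[min a b, max a b)}(θ)`), `integral_abs_indicator_Iio_sub`
(`∫ |𝟙_{θ<a} − 𝟙_{θ<b}| dθ = |a − b|`), `l1Dist_eq_sum_integral_cut`
(`Σ_k |f_k x − f_k y| = Σ_k ∫ |χ_{E_{k,θ}}(x) − χ_{E_{k,θ}}(y)| dθ`).

NOT here: cut measures of general `L₁(μ)`-valued maps, sets of finite perimeter.

## References

* [CheegerKleinerNaor2011] J. Cheeger, B. Kleiner, A. Naor, Acta Math. 207 (2011) 291–373, §2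
  (arXiv:0910.2026 p. 7).
-/

noncomputable section

open MeasureTheory Set

namespace Literature.Geometry.MetricEmbeddings

/-- Pointwise: `|𝟙_{θ<a} − 𝟙_{θ<b}| = 𝟙_{[min a b, max a b)}(θ)`.
[cite: CheegerKleinerNaor2011, §2 (arXiv p. 7)] -/
theorem abs_indicator_Iio_sub (a b θ : ℝ) :
    |(Iio a).indicator (1 : ℝ → ℝ) θ - (Iio b).indicator 1 θ| =
      (Ico (min a b) (max a b)).indicator 1 θ := by
  rcases lt_or_ge θ a with ha | ha <;> rcases lt_or_ge θ b with hb | hb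
  · have h3 : θ ∉ Ico (min a b) (max a b) := fun h => (lt_min ha hb).not_ge h.1
    simp [show θ ∈ Iio a from ha, show θ ∈ Iio b from hb, h3]
  · have h3 : θ ∈ Ico (min a b) (max a b) := ⟨min_le_of_right_le hb, lt_max_of_lt_left ha⟩
    simp [show θ ∈ Iio a from ha, show θ ∉ Iio b from not_lt.mpr hb, h3]
  · have h3 : θ ∈ Ico (min a b) (max a b) := ⟨min_le_of_left_le ha, lt_max_of_lt_right hb⟩
    simp [show θ ∉ Iio a from not_lt.mpr ha, show θ ∈ Iio b from hb, h3]
  · have h3 : θ ∉ Ico (min a b) (max a b) := fun h => (max_le ha hb).not_gt h.2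
    simp [show θ ∉ Iio a from not_lt.mpr ha, show θ ∉ Iio b from not_lt.mpr hb, h3]

/-- **One-dimensional layer cake for differences**: `|a − b| = ∫_ℝ |𝟙_{θ<a} − 𝟙_{θ<b}| dθ`
(the elementary cut metric on the line). [cite: CheegerKleinerNaor2011, §2 (arXiv p. 7)] -/
theorem integral_abs_indicator_Iio_sub (a b : ℝ) :
    ∫ θ, |(Iio a).indicator (1 : ℝ → ℝ) θ - (Iio b).indicator 1 θ| = |a - b| := by
  simp_rw [abs_indicator_Iio_sub]
  rw [integral_indicator_one measurableSet_Ico, Measure.real, Real.volume_Ico,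
    ENNReal.toReal_ofReal (sub_nonneg.mpr min_le_max)]
  rcases le_total a b with h | h
  · rw [max_eq_right h, min_eq_left h, abs_sub_comm, abs_of_nonneg (sub_nonneg.mpr h)]
  · rw [max_eq_left h, min_eq_right h, abs_of_nonneg (sub_nonneg.mpr h)]

/-- **The cut-cone representation of `ℓ₁^N`-distances** ([CKN §2, arXiv p. 7]: "the cut-cone
representation of `L₁` metrics … asserts that for every `f : ℍ → L₁` we can write
`‖f(x) − f(y)‖_{L₁} = ∫_{2^ℍ} |χ_E(x) − χ_E(y)| dΣ_f(E)`"), in the elementary case of an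
`ℓ₁^N`-valued map on an arbitrary type: the cut measure `Σ_f` is the image of
(counting measure on `Fin N`) ⊗ (Lebesgue measure on `ℝ`) under `(k, θ) ↦ E_{k,θ} = {p | θ < f_k(p)}`
(super-level sets of the coordinates), i.e.
`Σ_k |f_k(x) − f_k(y)| = Σ_k ∫_ℝ |χ_{E_{k,θ}}(x) − χ_{E_{k,θ}}(y)| dθ`.
(The finite-set version with finitely many cuts is `exists_cut_decomposition` in `CutCone.lean`.)
[cite: CheegerKleinerNaor2011, §2 (arXiv p. 7)] -/
theorem l1Dist_eq_sum_integral_cut {α : Type*} {N : ℕ} (f : α → Fin N → ℝ) (x y : α) :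
    ∑ k, |f x k - f y k| =
      ∑ k, ∫ θ : ℝ, |{p : α | θ < f p k}.indicator (1 : α → ℝ) x - {p : α | θ < f p k}.indicator 1 y| := by
  refine Finset.sum_congr rfl fun k _ => ?_
  rw [← integral_abs_indicator_Iio_sub]
  rfl

end Literature.Geometry.MetricEmbeddings

end
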